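import Literature.AlgebraicGeometry.Motives.MixedHodgeStructureAbelian
import Literature.AlgebraicGeometry.Motives.MixedHodgeStructureHodgeNumbersAdditive
import HarnessLib

/-!
# The lattice of sub-mixed Hodge structures: intersections, sums, images, preimages, `⊥`, `⊤`

In the abelian category of mixed Hodge structures (Cattani–El Zein–Griffiths–Lê, *Hodge Theory*,
Thm. 3.2.18; Deligne, *Théorie de Hodge II*, Thm. 2.3.5 (i)–(ii): sub-objects and quotients carry the
induced filtrations, Lemma 3.2.20) the sub-objects of `H` form a lattice and are preserved under
images and preimages by morphisms. With the criterion of `MixedHodgeStructureAbelian.lean` — a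
`ℚ`-subspace `K ⊆ V` underlies a sub-MHS iff `K_ℂ` is compatible with Deligne's splitting
`V_ℂ = ⊕ I^{p,q}` (`SubMixedHodgeStructure.ofCompatible`, `SubMixedHodgeStructure.baseChange_le_iSup_inf`;
Cattani et al., proof of Lemma 3.2.20) — these closure properties are immediate: compatibility is
stable under `⊓`, `⊔` (the components of `u₁ + u₂` are sums of components), images (`Hom.range` of
`f ∘ (S ↪ H₁)`) and preimages (`Hom.ker` of `H₁ → H₂ → H₂ / T`).

## Main results (all proved; no named facts)

* `SubMixedHodgeStructure.top`, `.bot`, `.inf`, `.sup` — `V`, `0`, `S ∩ T`, `S + T` as sub-MHS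
  (`_toSubmodule` lemmas);
* `SubMixedHodgeStructure.map f S` — the image `f(S) ⊆ H₂` of a sub-MHS; `SubMixedHodgeStructure.comap f T`
  — the preimage `f⁻¹(T) ⊆ H₁`;
* `SubMixedHodgeStructure.toSubmodule_injective` — a sub-MHS is determined by its subspace.
* `SubMixedHodgeStructure.weight H k` — **the weight filtration is a filtration by sub-MHS: `W_k H ⊆ H`
  is a sub-MHS** (`W_{k,ℂ} = ⊕_{p+q ≤ k} I^{p,q}`, Prop. 3.2.19), `weight_mono`; its Hodge numbers
  `hodgeNumber_weight_of_le` (`h^{p,q}(W_k) = h^{p,q}(H)` for `p + q ≤ k`), `hodgeNumber_weight_of_lt`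
  (`= 0` for `p + q > k`), and those of the quotient MHS `H / W_k`: `hodgeNumber_weight_quotient_of_le`
  (`= 0`), `hodgeNumber_weight_quotient_of_lt` (`= h^{p,q}(H)`).

## References

* [CattaniElZeinGriffithsLe2014] E. Cattani et al. (eds.), *Hodge Theory* (2014): Thm. 3.2.18,
  Lemma 3.2.20 and its proof (p. 161), Remark (ii) after Prop. 3.2.19.
* [DeligneHodgeII1971] P. Deligne, *Théorie de Hodge II*, Thm. 2.3.5 (i)–(ii).
-/

noncomputable section

open scoped TensorProduct

namespace Literature.AlgebraicGeometry.Motives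

namespace MixedHodgeStructure

namespace SubMixedHodgeStructure

universe u v

variable {V : Type u} [AddCommGroup V] [Module ℚ V]
variable {V' : Type v} [AddCommGroup V'] [Module ℚ V']
variable {H : MixedHodgeStructure V} {H₁ : MixedHodgeStructure V} {H₂ : MixedHodgeStructure V'}

open DirectSum Module

/-- A sub-MHS is determined by its underlying subspace (the opposedness field is a proposition).
[cite: CattaniElZeinGriffithsLe2014, Lemma 3.2.20] -/
theorem toSubmodule_injective : Function.Injective (toSubmodule : SubMixedHodgeStructure H → Submodule ℚ V) := by
  rintro ⟨S, hS⟩ ⟨T, hT⟩ h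
  cases h
  rfl

/-- Two sub-MHS with the same underlying subspace are equal. [cite: CattaniElZeinGriffithsLe2014, Lemma 3.2.20] -/
@[ext]
theorem ext {S T : SubMixedHodgeStructure H} (h : S.toSubmodule = T.toSubmodule) : S = T :=
  toSubmodule_injective h

/-- **`H` itself is a sub-MHS of `H`** (`V_ℂ` is compatible with `⊕ I^{p,q}`). [cite: CattaniElZeinGriffithsLe2014, Lemma 3.2.20] -/
def top (H : MixedHodgeStructure V) : SubMixedHodgeStructure H :=
  ofCompatible H ⊤ (by
    rw [Submodule.baseChange_top]
    simp only [top_inf_eq]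
    exact le_of_eq H.iSup_deligneFamily_eq_top.symm)

/-- The underlying subspace of `top` is `V`. [cite: CattaniElZeinGriffithsLe2014, Lemma 3.2.20] -/
@[simp]
theorem top_toSubmodule (H : MixedHodgeStructure V) : (top H).toSubmodule = ⊤ := rfl

/-- **`0` is a sub-MHS of `H`**. [cite: CattaniElZeinGriffithsLe2014, Lemma 3.2.20] -/
def bot (H : MixedHodgeStructure V) : SubMixedHodgeStructure H :=
  ofCompatible H ⊥ (by rw [Submodule.baseChange_bot]; exact bot_le)

/-- The underlying subspace of `bot` is `0`. [cite: CattaniElZeinGriffithsLe2014, Lemma 3.2.20] -/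
@[simp]
theorem bot_toSubmodule (H : MixedHodgeStructure V) : (bot H).toSubmodule = ⊥ := rfl

/-- **The intersection of two sub-MHS is a sub-MHS** (both are compatible with `⊕ I^{p,q}`, hence so
is `S_ℂ ∩ T_ℂ = (S ∩ T)_ℂ`; in the abelian category of MHS, `S ∩ T = Ker(H → H/S × H/T)`).
[cite: CattaniElZeinGriffithsLe2014, Lemma 3.2.20] -/
def inf (S T : SubMixedHodgeStructure H) : SubMixedHodgeStructure H :=
  ofCompatible H (S.toSubmodule ⊓ T.toSubmodule) (by
    classical
    letI : Decomposition H.deligneFamily := H.isInternal_deligneFamily.chooseDecomposition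
    rw [Literature.LinearAlgebra.BaseChange.baseChange_inf]
    refine H.le_iSup_inf_of_decompose_mem fun x hx pq => ⟨?_, ?_⟩
    · exact H.decompose_mem_of_le_iSup_inf S.baseChange_le_iSup_inf hx.1 pq
    · exact H.decompose_mem_of_le_iSup_inf T.baseChange_le_iSup_inf hx.2 pq)

/-- The underlying subspace of `S.inf T` is `S ∩ T`. [cite: CattaniElZeinGriffithsLe2014, Lemma 3.2.20] -/
@[simp]
theorem inf_toSubmodule (S T : SubMixedHodgeStructure H) :
    (S.inf T).toSubmodule = S.toSubmodule ⊓ T.toSubmodule := rfl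

/-- **The sum of two sub-MHS is a sub-MHS** (`(S + T)_ℂ = S_ℂ + T_ℂ` is compatible with `⊕ I^{p,q}`:
the components of `s + t` are `s^{p,q} + t^{p,q}`; in the abelian category, `S + T = Im(S ⊕ T → H)`).
[cite: CattaniElZeinGriffithsLe2014, Lemma 3.2.20] -/
def sup (S T : SubMixedHodgeStructure H) : SubMixedHodgeStructure H :=
  ofCompatible H (S.toSubmodule ⊔ T.toSubmodule) (by
    classical
    letI : Decomposition H.deligneFamily := H.isInternal_deligneFamily.chooseDecomposition
    rw [Literature.LinearAlgebra.BaseChange.baseChange_sup]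
    refine H.le_iSup_inf_of_decompose_mem fun x hx pq => ?_
    obtain ⟨s, hs, t, ht, rfl⟩ := Submodule.mem_sup.1 hx
    rw [decompose_add, DirectSum.add_apply, Submodule.coe_add]
    exact Submodule.add_mem_sup (H.decompose_mem_of_le_iSup_inf S.baseChange_le_iSup_inf hs pq)
      (H.decompose_mem_of_le_iSup_inf T.baseChange_le_iSup_inf ht pq))

/-- The underlying subspace of `S.sup T` is `S + T`. [cite: CattaniElZeinGriffithsLe2014, Lemma 3.2.20] -/
@[simp]
theorem sup_toSubmodule (S T : SubMixedHodgeStructure H) :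
    (S.sup T).toSubmodule = S.toSubmodule ⊔ T.toSubmodule := rfl

/-- **The image of a sub-MHS under a morphism is a sub-MHS**: `f(S) = Im(f ∘ (S ↪ H₁)) ⊆ H₂`
(Cattani et al., Lemma 3.2.20: images carry natural MHS). [cite: CattaniElZeinGriffithsLe2014, Lemma 3.2.20] -/
def map (f : MixedHodgeStructure.Hom H₁ H₂) (S : SubMixedHodgeStructure H₁) : SubMixedHodgeStructure H₂ :=
  ofCompatible H₂ (S.toSubmodule.map f.toLinearMap) (by
    have h := (f.comp S.subtype).range_baseChange_le_iSup_inf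
    rwa [show LinearMap.range (f.comp S.subtype).toLinearMap = S.toSubmodule.map f.toLinearMap from by
      rw [Hom.comp_toLinearMap, LinearMap.range_comp]; exact congrArg _ (Submodule.range_subtype _)] at h)

/-- The underlying subspace of `S.map f` is `f(S)`. [cite: CattaniElZeinGriffithsLe2014, Lemma 3.2.20] -/
@[simp]
theorem map_toSubmodule (f : MixedHodgeStructure.Hom H₁ H₂) (S : SubMixedHodgeStructure H₁) :
    (S.map f).toSubmodule = S.toSubmodule.map f.toLinearMap := rfl

/-- **The preimage of a sub-MHS under a morphism is a sub-MHS**: `f⁻¹(T) = Ker(H₁ → H₂ → H₂ / T)`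
(Cattani et al., Lemma 3.2.20: kernels carry natural MHS). [cite: CattaniElZeinGriffithsLe2014, Lemma 3.2.20] -/
def comap (f : MixedHodgeStructure.Hom H₁ H₂) (T : SubMixedHodgeStructure H₂) : SubMixedHodgeStructure H₁ :=
  ofCompatible H₁ (T.toSubmodule.comap f.toLinearMap) (by
    have h := (T.mkQ.comp f).ker_baseChange_le_iSup_inf
    rwa [show LinearMap.ker (T.mkQ.comp f).toLinearMap = T.toSubmodule.comap f.toLinearMap from by
      rw [Hom.comp_toLinearMap, LinearMap.ker_comp]; exact congrArg _ (Submodule.ker_mkQ _)] at h)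

/-- The underlying subspace of `T.comap f` is `f⁻¹(T)`. [cite: CattaniElZeinGriffithsLe2014, Lemma 3.2.20] -/
@[simp]
theorem comap_toSubmodule (f : MixedHodgeStructure.Hom H₁ H₂) (T : SubMixedHodgeStructure H₂) :
    (T.comap f).toSubmodule = T.toSubmodule.comap f.toLinearMap := rfl

/-- `Ker f = f⁻¹(0)` as sub-MHS. [cite: CattaniElZeinGriffithsLe2014, Lemma 3.2.20] -/
theorem comap_bot_eq_ker (f : MixedHodgeStructure.Hom H₁ H₂) : (bot H₂).comap f = f.ker :=
  ext (by rw [comap_toSubmodule, bot_toSubmodule, Submodule.comap_bot, Hom.ker_toSubmodule])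

/-- `Im f = f(V)` as sub-MHS. [cite: CattaniElZeinGriffithsLe2014, Lemma 3.2.20] -/
theorem map_top_eq_range (f : MixedHodgeStructure.Hom H₁ H₂) : (top H₁).map f = f.range :=
  ext (by rw [map_toSubmodule, top_toSubmodule, Submodule.map_top, Hom.range_toSubmodule])

/-- A sub-MHS of a sub-MHS is a sub-MHS: the image under the inclusion `S ↪ H` of a sub-MHS of `S`.
[cite: CattaniElZeinGriffithsLe2014, Lemma 3.2.20] -/
def ofSub (S : SubMixedHodgeStructure H) (R : SubMixedHodgeStructure S.toMixedHodgeStructure) :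
    SubMixedHodgeStructure H :=
  R.map S.subtype

/-- The underlying subspace of `S.ofSub R` is `R ⊆ S ⊆ V`. [cite: CattaniElZeinGriffithsLe2014, Lemma 3.2.20] -/
@[simp]
theorem ofSub_toSubmodule (S : SubMixedHodgeStructure H) (R : SubMixedHodgeStructure S.toMixedHodgeStructure) :
    (S.ofSub R).toSubmodule = R.toSubmodule.map S.toSubmodule.subtype := rfl

/-- `S.ofSub R ≤ S`. [cite: CattaniElZeinGriffithsLe2014, Lemma 3.2.20] -/
theorem ofSub_toSubmodule_le (S : SubMixedHodgeStructure H) (R : SubMixedHodgeStructure S.toMixedHodgeStructure) :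
    (S.ofSub R).toSubmodule ≤ S.toSubmodule := by
  rw [ofSub_toSubmodule]
  exact Submodule.map_subtype_le _ _

/-! ### The weight filtration is a filtration by sub-MHS -/

/-- **`W_k H` is a sub-mixed Hodge structure of `H`**: `W_{k,ℂ} = ⊕_{p+q ≤ k} I^{p,q}` is compatible
with Deligne's splitting (Cattani et al., Prop. 3.2.19: `W_n = ⊕_{p+q ≤ n} I^{p,q}`), so the induced
filtrations make `W_k` an MHS (Lemma 3.2.20) — the weight filtration is a finite increasing filtration
of `H` by sub-objects with pure graded quotients `Gr^W_k`. [cite: CattaniElZeinGriffithsLe2014, Prop. 3.2.19 and Lemma 3.2.20] -/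
def weight (H : MixedHodgeStructure V) (k : ℤ) : SubMixedHodgeStructure H :=
  ofCompatible H (H.W k) (by
    classical
    letI : Decomposition H.deligneFamily := H.isInternal_deligneFamily.chooseDecomposition
    refine H.le_iSup_inf_of_decompose_mem fun x hx pq => ?_
    by_cases hpq : k < pq.1 + pq.2
    · rw [(H.mem_baseChange_W_iff_decompose k x).1 hx pq hpq]
      exact zero_mem _
    · exact Submodule.baseChange_mono ℂ (H.monotone_W (not_lt.1 hpq))
        (H.deligneI_le_W pq.1 pq.2 (decompose H.deligneFamily x pq).2))

/-- The underlying subspace of `weight H k` is `W_k`. [cite: CattaniElZeinGriffithsLe2014, Prop. 3.2.19] -/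
@[simp]
theorem weight_toSubmodule (H : MixedHodgeStructure V) (k : ℤ) : (weight H k).toSubmodule = H.W k := rfl

/-- `k ↦ W_k` is increasing (as sub-MHS subspaces). [cite: CattaniElZeinGriffithsLe2014, Def. 3.2.15] -/
theorem weight_mono (H : MixedHodgeStructure V) {j k : ℤ} (h : j ≤ k) :
    (weight H j).toSubmodule ≤ (weight H k).toSubmodule :=
  H.monotone_W h

/-- `I^{p,q}(H) ⊆ W_{k,ℂ}` for `p + q ≤ k`. [cite: CattaniElZeinGriffithsLe2014, Prop. 3.2.19] -/
theorem deligneI_le_baseChange_W_of_le (H : MixedHodgeStructure V) {p q k : ℤ} (h : p + q ≤ k) :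
    H.deligneI p q ≤ (H.W k).baseChange ℂ :=
  (H.deligneI_le_W p q).trans (Submodule.baseChange_mono ℂ (H.monotone_W h))

/-- `I^{p,q}(H) ∩ W_{k,ℂ} = 0` for `p + q > k` (`I^{p,q} ∩ W_{p+q-1} = 0`, Prop. 3.2.19).
[cite: CattaniElZeinGriffithsLe2014, Prop. 3.2.19] -/
theorem deligneI_inf_baseChange_W_of_lt (H : MixedHodgeStructure V) {p q k : ℤ} (h : k < p + q) :
    H.deligneI p q ⊓ (H.W k).baseChange ℂ = ⊥ :=
  eq_bot_iff.2 ((inf_le_inf_left _ (Submodule.baseChange_mono ℂ (H.monotone_W (show k ≤ p + q - 1 by omega)))).trans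
    (le_of_eq (H.deligneI_inf_W_pred_eq_bot p q)))

/-- **`h^{p,q}(W_k) = h^{p,q}(H)` for `p + q ≤ k`** (`I^{p,q}(W_k) = W_{k,ℂ} ∩ I^{p,q}(H) = I^{p,q}(H)`).
[cite: CattaniElZeinGriffithsLe2014, Prop. 3.2.19] -/
theorem hodgeNumber_weight_of_le [FiniteDimensional ℚ V] (H : MixedHodgeStructure V) {p q k : ℤ}
    (h : p + q ≤ k) : (weight H k).toMixedHodgeStructure.hodgeNumber p q = H.hodgeNumber p q := by
  rw [← finrank_deligneI_eq_hodgeNumber, ← finrank_deligneI_eq_hodgeNumber,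
    LinearEquiv.finrank_eq (Submodule.equivMapOfInjective _
      (baseChange_injective (weight H k).toSubmodule.injective_subtype) _),
    (weight H k).map_deligneI_eq, weight_toSubmodule, inf_eq_right.2 (deligneI_le_baseChange_W_of_le H h)]

/-- **`h^{p,q}(W_k) = 0` for `p + q > k`** (`I^{p,q}(W_k) = W_{k,ℂ} ∩ I^{p,q}(H) = 0`).
[cite: CattaniElZeinGriffithsLe2014, Prop. 3.2.19] -/
theorem hodgeNumber_weight_of_lt [FiniteDimensional ℚ V] (H : MixedHodgeStructure V) {p q k : ℤ}
    (h : k < p + q) : (weight H k).toMixedHodgeStructure.hodgeNumber p q = 0 := by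
  rw [← finrank_deligneI_eq_hodgeNumber,
    LinearEquiv.finrank_eq (Submodule.equivMapOfInjective _
      (baseChange_injective (weight H k).toSubmodule.injective_subtype) _),
    (weight H k).map_deligneI_eq, weight_toSubmodule, inf_comm, deligneI_inf_baseChange_W_of_lt H h,
    finrank_bot]

/-- **`h^{p,q}(H / W_k) = 0` for `p + q ≤ k`** (additivity `h(H) = h(W_k) + h(H / W_k)`, Cor. 3.2.21 (ii)).
[cite: CattaniElZeinGriffithsLe2014, Cor. 3.2.21 (ii)] -/
theorem hodgeNumber_weight_quotient_of_le [FiniteDimensional ℚ V] (H : MixedHodgeStructure V)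
    {p q k : ℤ} (h : p + q ≤ k) : (weight H k).quotient.hodgeNumber p q = 0 := by
  have h' := (weight H k).hodgeNumber_eq_add p q
  rw [hodgeNumber_weight_of_le H h] at h'
  omega

/-- **`h^{p,q}(H / W_k) = h^{p,q}(H)` for `p + q > k`**. [cite: CattaniElZeinGriffithsLe2014, Cor. 3.2.21 (ii)] -/
theorem hodgeNumber_weight_quotient_of_lt [FiniteDimensional ℚ V] (H : MixedHodgeStructure V)
    {p q k : ℤ} (h : k < p + q) : (weight H k).quotient.hodgeNumber p q = H.hodgeNumber p q := by
  have h' := (weight H k).hodgeNumber_eq_add p q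
  rw [hodgeNumber_weight_of_lt H h, zero_add] at h'
  exact h'.symm

end SubMixedHodgeStructure

end MixedHodgeStructure

end Literature.AlgebraicGeometry.Motives

end
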